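import Mathlib
import Literature.Analysis.FluidPDE.SuitableWeak
import Literature.Analysis.FluidPDE.Seregin2023.TypeIIEulerZoom
import Summits.NavierStokesRegularity.NavierStokesRegularity.Theses.EulerZoomLiouville
import Summits.NavierStokesRegularity.NavierStokesRegularity.Theorems.EulerZoomLiouvillePowerGaugeEulerLiouvilleAxisymDSSPow
import Summits.NavierStokesRegularity.NavierStokesRegularity.Theorems.EulerZoomLiouvillePowerGaugeEulerLiouvilleAxisymSelfSimilarProfile
import Summits.NavierStokesRegularity.NavierStokesRegularity.Theorems.EulerZoomLiouvillePowerGaugeEulerLiouvilleVorticitySupportConservation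
import HarnessLib

/-!
# The SYMMETRY-FREE discretely self-similar stratum of the crux `EulerZoomLiouville.PowerGaugeEulerLiouville`
# with vorticity support of finite measure (route №10, item stmt-NavierStokesRegularity-19832) — every `ρ > 0`

Helper file (theorems only; `--supports stmt-NavierStokesRegularity-19832`). Seat ns-typeII-p3 (cell
ns-regularity-ideate §B, D-0081). Rung C2 (discretely self-similar members) of
`Cruxes/PowerGaugeEulerLiouville/Lines/rungC_window.lean` WITHOUT any symmetry assumption.

THE STRATUM (`ae_eq_zero_of_gauge_of_dss_vorticitySupport`; binder forms
`powerGaugeEulerLiouville_dss_vorticitySupport`, `powerGaugeEulerLiouville_selfSimilar_vorticitySupport`).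
A member `(u, p, H, c)` of Seregin's power-gauged ancient Euler class (exponent `ρ > 0`; the crux's three
hypotheses VERBATIM) which is a classical Euler solution on the open slab, DISCRETELY SELF-SIMILAR for the
class scaling with a factor `l > 1` (`u(τ,y) = l^{1+ρ} u(l^{2+ρ}τ, l y)`; exactly self-similar = every
factor), with bounded velocity and velocity gradient on compact time intervals, and whose VORTICITY SUPPORT
`{x : curl u(τ) x ≠ 0}` has finite measure, bounded on compact time intervals (e.g. compactly supported
vorticity), vanishes a.e. on the slab.

THE LEVER (Helmholtz, Eulerian form, prequels `…VorticitySupport{Tools,Limits,Conservation}.lean`): along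
a classical Euler flow the measure of the vorticity support is CONSERVED
(`volume_vorticitySupport_eq_of_classical`); the class scaling maps `curl u(τ) = l^{2+ρ} (curl u(l^{2+ρ}τ))(l ·)`,
so `{curl u(τ) ≠ 0} = l⁻¹ · {curl u(l^{2+ρ}τ) ≠ 0}` has `l⁻³` times the measure; `l⁻³ ≠ 1` forces measure
`0`, an open set of measure zero is empty, so every slice is irrotational and the assembly lemma
`ae_eq_zero_of_gauge_of_curl_slice_eq_zero` (the lead's `A`-gauge harmonic Liouville) finishes.

In print: Chae–Tsai, MRL 21 (2014) Thm 2.1 (time-periodic profile form; `ω ∈ ∩_{0<q<r} L^q(ℝ³ × [0,S₀])`,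
bounded first derivatives, `V → 0` at infinity for the closing harmonic Liouville) — the `q ↓ 0` limit of
`∫|ω|^q` is the support measure used here; our hypothesis is the geometric one (finite-measure support),
no decay of `V` is needed (the class's `A`-gauge closes), and the proof is Eulerian (no particle
trajectories). WHAT THIS IS NOT: not NS, not the crux E, not rung C2 whole — DSS members whose vorticity
support has infinite measure (the generic expectation for collapse profiles with algebraic tails) are
untouched. [folklore]
-/

noncomputable section

-- the summit and its single problem share the name `NavierStokesRegularity` (D-0017 nested layout)
set_option linter.dupNamespace false

open Set Function Filter Topology MeasureTheory Metric Module
open scoped NNReal ENNReal InnerProductSpace RealInnerProductSpace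

namespace Summit.NavierStokesRegularity.NavierStokesRegularity.Theorems.PowerGaugeEulerLiouville.VorticitySupport

open Literature.Analysis Literature.Analysis.FluidPDE
open Summit.NavierStokesRegularity.NavierStokesRegularity.Theorems.PowerGaugeEulerLiouville
open Summit.NavierStokesRegularity.NavierStokesRegularity.Theorems.PowerGaugeEulerLiouville.AxisymNoSwirl

/-! ## The vorticity support under dilations -/

/-- The vorticity support of `c • v(λ ·)` is the `λ`-preimage of that of `v` (`c λ ≠ 0`). [folklore] -/
theorem vorticitySupport_smul_comp_smul {v : (EuclideanSpace ℝ (Fin 3)) → (EuclideanSpace ℝ (Fin 3))}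
    (hv : Differentiable ℝ v) {c lam : ℝ} (hc : c ≠ 0) (hlam : lam ≠ 0) :
    {y | curl (fun z : (EuclideanSpace ℝ (Fin 3)) => c • v (lam • z)) y ≠ 0} =
      (fun y : (EuclideanSpace ℝ (Fin 3)) => lam • y) ⁻¹' {y | curl v y ≠ 0} := by
  ext y
  simp only [mem_setOf_eq, mem_preimage, curl_smul_comp_smul hv c lam y, smul_ne_zero_iff,
    mul_ne_zero_iff, hc, hlam, ne_eq, not_false_eq_true, true_and]

/-- **Measure of the vorticity support under dilations**: `vol {curl (c • v(λ ·)) ≠ 0} = |λ³|⁻¹ vol {curl v ≠ 0}`.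
[folklore] -/
theorem volume_vorticitySupport_smul_comp_smul {v : (EuclideanSpace ℝ (Fin 3)) → (EuclideanSpace ℝ (Fin 3))}
    (hv : Differentiable ℝ v) {c lam : ℝ} (hc : c ≠ 0) (hlam : lam ≠ 0) :
    volume {y | curl (fun z : (EuclideanSpace ℝ (Fin 3)) => c • v (lam • z)) y ≠ 0} =
      ENNReal.ofReal (|(lam ^ 3)⁻¹|) * volume {y | curl v y ≠ 0} := by
  rw [vorticitySupport_smul_comp_smul hv hc hlam, Measure.addHaar_preimage_smul volume hlam,
    finrank_euclideanSpace_fin]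

/-! ## DSS members with finite-measure vorticity support are irrotational -/

/-- **Every slice of a DSS classical Euler flow with finite-measure vorticity support is irrotational.**
Conservation gives `vol S(τ) = vol S(l^{2+ρ}τ)`, scaling gives `vol S(τ) = l⁻³ vol S(l^{2+ρ}τ)`; with
`vol < ∞` and `l⁻³ < 1` both vanish, and an open null set is empty. [folklore] -/
theorem curl_slice_eq_zero_of_dss_vorticitySupport {ρ : ℝ} (hρ : 0 < ρ)
    {u : ℝ → (EuclideanSpace ℝ (Fin 3)) → (EuclideanSpace ℝ (Fin 3))} {p : ℝ → (EuclideanSpace ℝ (Fin 3)) → ℝ}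
    (hns : IsClassicalNSSolutionOn (Iio 0) 0 0 u p)
    {l : ℝ} (hl : 1 < l)
    (hdss : ∀ τ : ℝ, τ < 0 → ∀ y, u τ y = (l ^ (1 + ρ)) • u ((l ^ (2 + ρ)) * τ) (l • y))
    (hbdd : ∀ s t : ℝ, s < t → t < 0 → ∃ B : ℝ, ∀ τ ∈ Icc s t, ∀ y,
      ‖u τ y‖ ≤ B ∧ ‖fderiv ℝ (u τ) y‖ ≤ B)
    (hsupp : ∀ s t : ℝ, s < t → t < 0 → ∃ N : ℝ≥0, ∀ τ ∈ Icc s t,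
      volume {y | curl (u τ) y ≠ 0} ≤ N)
    {τ : ℝ} (hτ : τ < 0) (x : (EuclideanSpace ℝ (Fin 3))) : curl (u τ) x = 0 := by
  have hl0 : 0 < l := zero_lt_one.trans hl
  have hL : 1 < l ^ (2 + ρ) := Real.one_lt_rpow hl (by linarith)
  set τ' : ℝ := l ^ (2 + ρ) * τ with hτ'
  have hτ'τ : τ' < τ := by
    have : τ' - τ = (l ^ (2 + ρ) - 1) * τ := by rw [hτ']; ring
    nlinarith
  have hτ'0 : τ' < 0 := hτ'τ.trans hτ
  -- scaling of the support measure
  have hfun : u τ = fun y => (l ^ (1 + ρ)) • u τ' (l • y) := funext fun y => hdss τ hτ y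
  have hd : Differentiable ℝ (u τ') := (hns.contDiff_velocity hτ'0).differentiable (by simp)
  have hc : l ^ (1 + ρ) ≠ 0 := (Real.rpow_pos_of_pos hl0 _).ne'
  have hscale : volume {y | curl (u τ) y ≠ 0} =
      ENNReal.ofReal (|(l ^ 3)⁻¹|) * volume {y | curl (u τ') y ≠ 0} := by
    rw [hfun]; exact volume_vorticitySupport_smul_comp_smul hd hc hl0.ne'
  -- conservation
  obtain ⟨B, hB⟩ := hbdd τ' τ hτ'τ hτ
  obtain ⟨N, hN⟩ := hsupp τ' τ hτ'τ hτ
  have hcons := volume_vorticitySupport_eq_of_classical hns hτ'τ hτ hB hN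
  -- `vol S(τ') (1 - l⁻³) = 0` with `vol S(τ') < ∞`
  have hfin : volume {y | curl (u τ') y ≠ 0} ≠ ⊤ :=
    ne_top_of_le_ne_top ENNReal.coe_ne_top (hN τ' ⟨le_rfl, hτ'τ.le⟩)
  have hq : |(l ^ 3)⁻¹| < 1 := by
    rw [abs_of_pos (by positivity)]
    exact inv_lt_one_of_one_lt₀ (one_lt_pow₀ hl three_ne_zero)
  have hq0 : 0 ≤ |(l ^ 3)⁻¹| := abs_nonneg _
  have hzero : volume {y | curl (u τ') y ≠ 0} = 0 := by
    set V := volume {y | curl (u τ') y ≠ 0} with hV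
    have h1 : V = ENNReal.ofReal (|(l ^ 3)⁻¹|) * V := by rw [hV, ← hscale, hcons]
    have h2 : V.toReal = |(l ^ 3)⁻¹| * V.toReal := by
      have := congrArg ENNReal.toReal h1
      rwa [ENNReal.toReal_mul, ENNReal.toReal_ofReal hq0] at this
    have h3 : V.toReal = 0 := by nlinarith [ENNReal.toReal_nonneg (a := V)]
    exact (ENNReal.toReal_eq_zero_iff _).1 h3 |>.resolve_right hfin
  -- back to `τ`: `vol S(τ) = 0`, open ⇒ empty
  have hzeroτ : volume {y | curl (u τ) y ≠ 0} = 0 := by rw [hcons, hzero]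
  have hopen : IsOpen {y | curl (u τ) y ≠ 0} :=
    isOpen_vorticitySupport ((hns.contDiff_velocity hτ).of_le (by norm_cast))
  have hempty := (hopen.measure_eq_zero_iff volume).1 hzeroτ
  by_contra hx
  have : x ∈ {y | curl (u τ) y ≠ 0} := hx
  rw [hempty] at this
  exact this

/-! ## The symmetry-free DSS stratum -/

/-- **The DSS stratum of the crux `PowerGaugeEulerLiouville` with finite-measure vorticity support**
(every `ρ > 0`; rung C2 of `Lines/rungC_window.lean`, no symmetry; conditional on classical regularity,
bounded `u`/`∇u` and bounded support measure on compact time intervals). [folklore] -/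
theorem ae_eq_zero_of_gauge_of_dss_vorticitySupport {ρ : ℝ} (hρ : 0 < ρ)
    {u : ℝ → (EuclideanSpace ℝ (Fin 3)) → (EuclideanSpace ℝ (Fin 3))} {p : ℝ → (EuclideanSpace ℝ (Fin 3)) → ℝ}
    {H : ℝ → (EuclideanSpace ℝ (Fin 3)) → (EuclideanSpace ℝ (Fin 3)) →L[ℝ] (EuclideanSpace ℝ (Fin 3))} {c : ℝ≥0}
    (hH : HasWeakSpatialGradientOn (slab (EuclideanSpace ℝ (Fin 3)) (Iio 0) isOpen_Iio) u H)
    (hc : ∀ a : ℝ, 0 < a → ENNReal.ofReal (a ^ (2 * ρ)) * cknA a (0 : ℝ × (EuclideanSpace ℝ (Fin 3))) u +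
        ENNReal.ofReal (a ^ ρ) * cknE a (0 : ℝ × (EuclideanSpace ℝ (Fin 3))) H +
        ENNReal.ofReal (a ^ (2 * ρ)) * cknD a (0 : ℝ × (EuclideanSpace ℝ (Fin 3))) p ≤ (c : ℝ≥0∞))
    (hns : IsClassicalNSSolutionOn (Iio 0) 0 0 u p)
    {l : ℝ} (hl : 1 < l)
    (hdss : ∀ τ : ℝ, τ < 0 → ∀ y, u τ y = (l ^ (1 + ρ)) • u ((l ^ (2 + ρ)) * τ) (l • y))
    (hbdd : ∀ s t : ℝ, s < t → t < 0 → ∃ B : ℝ, ∀ τ ∈ Icc s t, ∀ y,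
      ‖u τ y‖ ≤ B ∧ ‖fderiv ℝ (u τ) y‖ ≤ B)
    (hsupp : ∀ s t : ℝ, s < t → t < 0 → ∃ N : ℝ≥0, ∀ τ ∈ Icc s t,
      volume {y | curl (u τ) y ≠ 0} ≤ N) :
    uncurry u =ᵐ[volume.restrict (Iio (0 : ℝ) ×ˢ (univ : Set (EuclideanSpace ℝ (Fin 3))))] 0 :=
  ae_eq_zero_of_gauge_of_curl_slice_eq_zero (by linarith) hH hc hns fun _ hτ =>
    curl_slice_eq_zero_of_dss_vorticitySupport hρ hns hl hdss hbdd hsupp hτ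

/-- **The stratum in the crux's binder shape**: the crux `PowerGaugeEulerLiouville` VERBATIM with the extra
hypotheses «classical on the open slab, DSS with factor `l > 1`, bounded `u`/`∇u` and bounded measure of
the vorticity support `{curl u(τ) ≠ 0}` on compact time intervals» — NO symmetry. [folklore] -/
theorem powerGaugeEulerLiouville_dss_vorticitySupport :
    ∀ ρ : ℝ, 0 < ρ → ∀ (u : ℝ → EuclideanSpace ℝ (Fin 3) → EuclideanSpace ℝ (Fin 3))
      (p : ℝ → EuclideanSpace ℝ (Fin 3) → ℝ)
      (H : ℝ → EuclideanSpace ℝ (Fin 3) → EuclideanSpace ℝ (Fin 3) →L[ℝ] EuclideanSpace ℝ (Fin 3)) (c : ℝ≥0)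
      (l : ℝ),
      IsSuitableWeakSolutionOn (slab (EuclideanSpace ℝ (Fin 3)) (Set.Iio 0) isOpen_Iio) 0 0 u p →
      HasWeakSpatialGradientOn (slab (EuclideanSpace ℝ (Fin 3)) (Set.Iio 0) isOpen_Iio) u H →
      (∀ a : ℝ, 0 < a → ENNReal.ofReal (a ^ (2 * ρ)) * cknA a (0 : ℝ × EuclideanSpace ℝ (Fin 3)) u +
        ENNReal.ofReal (a ^ ρ) * cknE a (0 : ℝ × EuclideanSpace ℝ (Fin 3)) H +
        ENNReal.ofReal (a ^ (2 * ρ)) * cknD a (0 : ℝ × EuclideanSpace ℝ (Fin 3)) p ≤ (c : ℝ≥0∞)) →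
      IsClassicalNSSolutionOn (Set.Iio 0) 0 0 u p →
      1 < l →
      (∀ τ : ℝ, τ < 0 → ∀ y, u τ y = (l ^ (1 + ρ)) • u ((l ^ (2 + ρ)) * τ) (l • y)) →
      (∀ s t : ℝ, s < t → t < 0 → ∃ B : ℝ, ∀ τ ∈ Set.Icc s t, ∀ y,
        ‖u τ y‖ ≤ B ∧ ‖fderiv ℝ (u τ) y‖ ≤ B) →
      (∀ s t : ℝ, s < t → t < 0 → ∃ N : ℝ≥0, ∀ τ ∈ Set.Icc s t,
        volume {y | curl (u τ) y ≠ 0} ≤ N) →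
      Function.uncurry u =ᵐ[volume.restrict (Set.Iio (0 : ℝ) ×ˢ (Set.univ : Set (EuclideanSpace ℝ (Fin 3))))] 0 :=
  fun _ hρ _ _ _ _ _ _ hH hc hns hl hdss hbdd hsupp =>
    ae_eq_zero_of_gauge_of_dss_vorticitySupport hρ hH hc hns hl hdss hbdd hsupp

/-- **Rung C1, no symmetry (conditional): no exactly self-similar Euler collapse in the power-gauged class
with vorticity support of finite measure** — every `ρ > 0`, classical members, bounded `u`/`∇u` and
bounded support measure on compact time intervals. [folklore] -/
theorem powerGaugeEulerLiouville_selfSimilar_vorticitySupport :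
    ∀ ρ : ℝ, 0 < ρ → ∀ (u : ℝ → EuclideanSpace ℝ (Fin 3) → EuclideanSpace ℝ (Fin 3))
      (p : ℝ → EuclideanSpace ℝ (Fin 3) → ℝ)
      (H : ℝ → EuclideanSpace ℝ (Fin 3) → EuclideanSpace ℝ (Fin 3) →L[ℝ] EuclideanSpace ℝ (Fin 3)) (c : ℝ≥0)
      (V : EuclideanSpace ℝ (Fin 3) → EuclideanSpace ℝ (Fin 3)),
      IsSuitableWeakSolutionOn (slab (EuclideanSpace ℝ (Fin 3)) (Set.Iio 0) isOpen_Iio) 0 0 u p →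
      HasWeakSpatialGradientOn (slab (EuclideanSpace ℝ (Fin 3)) (Set.Iio 0) isOpen_Iio) u H →
      (∀ a : ℝ, 0 < a → ENNReal.ofReal (a ^ (2 * ρ)) * cknA a (0 : ℝ × EuclideanSpace ℝ (Fin 3)) u +
        ENNReal.ofReal (a ^ ρ) * cknE a (0 : ℝ × EuclideanSpace ℝ (Fin 3)) H +
        ENNReal.ofReal (a ^ (2 * ρ)) * cknD a (0 : ℝ × EuclideanSpace ℝ (Fin 3)) p ≤ (c : ℝ≥0∞)) →
      IsClassicalNSSolutionOn (Set.Iio 0) 0 0 u p →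
      (∀ τ : ℝ, τ < 0 → ∀ y : EuclideanSpace ℝ (Fin 3),
        u τ y = ((-τ) ^ (-((1 + ρ) / (2 + ρ)))) • V (((-τ) ^ (-(1 / (2 + ρ)))) • y)) →
      (∀ s t : ℝ, s < t → t < 0 → ∃ B : ℝ, ∀ τ ∈ Set.Icc s t, ∀ y,
        ‖u τ y‖ ≤ B ∧ ‖fderiv ℝ (u τ) y‖ ≤ B) →
      (∀ s t : ℝ, s < t → t < 0 → ∃ N : ℝ≥0, ∀ τ ∈ Set.Icc s t,
        volume {y | curl (u τ) y ≠ 0} ≤ N) →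
      Function.uncurry u =ᵐ[volume.restrict (Set.Iio (0 : ℝ) ×ˢ (Set.univ : Set (EuclideanSpace ℝ (Fin 3))))] 0 :=
  fun _ hρ _ _ _ _ _ _ hH hc hns hss hbdd hsupp =>
    ae_eq_zero_of_gauge_of_dss_vorticitySupport hρ hH hc hns one_lt_two (dss_of_selfSimilar hρ hss two_pos)
      hbdd hsupp


/-! ## Profile form -/

/-- **Slice support measures from the profile**: for an exactly self-similar field,
`vol {curl u(τ) ≠ 0} = (−τ)^{3/(2+ρ)} vol {curl V ≠ 0}`, bounded on `[s, t] ⊂ (−∞, 0)` by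
`(−s)^{3/(2+ρ)} vol {curl V ≠ 0}`. [folklore] -/
theorem selfSimilar_vorticitySupport_bounds {ρ : ℝ} (hρ : 0 < ρ)
    {u : ℝ → (EuclideanSpace ℝ (Fin 3)) → (EuclideanSpace ℝ (Fin 3))} {V : (EuclideanSpace ℝ (Fin 3)) → (EuclideanSpace ℝ (Fin 3))}
    (hss : ∀ τ : ℝ, τ < 0 → ∀ y : (EuclideanSpace ℝ (Fin 3)),
      u τ y = ((-τ) ^ (-((1 + ρ) / (2 + ρ)))) • V (((-τ) ^ (-(1 / (2 + ρ)))) • y))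
    (hVd : Differentiable ℝ V) (hfin : volume {y | curl V y ≠ 0} ≠ ⊤) :
    ∀ s t : ℝ, s < t → t < 0 → ∃ N : ℝ≥0, ∀ τ ∈ Icc s t, volume {y | curl (u τ) y ≠ 0} ≤ N := by
  intro s t hst ht
  have h2ρ : 0 < 2 + ρ := by linarith
  have hn0 : 0 ≤ 1 / (2 + ρ) := div_nonneg zero_le_one h2ρ.le
  set mS : ℝ := (-s) ^ (1 / (2 + ρ)) with hmS
  have hmS0 : 0 ≤ mS := Real.rpow_nonneg (by linarith) _
  refine ⟨Real.toNNReal (mS ^ 3 * (volume {y | curl V y ≠ 0}).toReal), fun τ hτ => ?_⟩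
  have hτ0 : 0 < -τ := by linarith [hτ.2]
  have hτs : -τ ≤ -s := by linarith [hτ.1]
  set c : ℝ := (-τ) ^ (-((1 + ρ) / (2 + ρ))) with hc
  set lam : ℝ := (-τ) ^ (-(1 / (2 + ρ))) with hlam
  have hc0 : 0 < c := Real.rpow_pos_of_pos hτ0 _
  have hlam0 : 0 < lam := Real.rpow_pos_of_pos hτ0 _
  have hlaminv : lam⁻¹ = (-τ) ^ (1 / (2 + ρ)) := by
    rw [hlam, Real.rpow_neg hτ0.le, inv_inv]
  have hlaminvle : lam⁻¹ ≤ mS := by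
    rw [hlaminv]; exact Real.rpow_le_rpow hτ0.le hτs hn0
  have hfun : u τ = fun y => c • V (lam • y) := funext fun y => hss τ (by linarith [hτ.2]) y
  rw [hfun, volume_vorticitySupport_smul_comp_smul hVd hc0.ne' hlam0.ne']
  have habs : |(lam ^ 3)⁻¹| = (lam⁻¹) ^ 3 := by
    rw [abs_of_pos (by positivity), inv_pow]
  have hvS : volume {y | curl V y ≠ 0} = ENNReal.ofReal ((volume {y | curl V y ≠ 0}).toReal) :=
    (ENNReal.ofReal_toReal hfin).symm
  rw [habs]
  calc ENNReal.ofReal ((lam⁻¹) ^ 3) * volume {y | curl V y ≠ 0}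
      = ENNReal.ofReal ((lam⁻¹) ^ 3 * (volume {y | curl V y ≠ 0}).toReal) := by
        rw [ENNReal.ofReal_mul (by positivity), ← hvS]
    _ ≤ ENNReal.ofReal (mS ^ 3 * (volume {y | curl V y ≠ 0}).toReal) :=
        ENNReal.ofReal_le_ofReal (mul_le_mul_of_nonneg_right
          (pow_le_pow_left₀ (inv_nonneg.2 hlam0.le) hlaminvle 3) ENNReal.toReal_nonneg)
    _ = (Real.toNNReal (mS ^ 3 * (volume {y | curl V y ≠ 0}).toReal) : ℝ≥0∞) := rfl

/-- **Rung C1, no symmetry, PROFILE form: no exactly self-similar Euler collapse in the power-gauged class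
whose profile `V` is bounded with bounded gradient and has vorticity support of finite measure** (e.g.
compactly supported profile vorticity), every `ρ > 0`, classical members. [folklore] -/
theorem powerGaugeEulerLiouville_selfSimilar_vorticitySupport_profile :
    ∀ ρ : ℝ, 0 < ρ → ∀ (u : ℝ → EuclideanSpace ℝ (Fin 3) → EuclideanSpace ℝ (Fin 3))
      (p : ℝ → EuclideanSpace ℝ (Fin 3) → ℝ)
      (H : ℝ → EuclideanSpace ℝ (Fin 3) → EuclideanSpace ℝ (Fin 3) →L[ℝ] EuclideanSpace ℝ (Fin 3)) (c : ℝ≥0)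
      (V : EuclideanSpace ℝ (Fin 3) → EuclideanSpace ℝ (Fin 3)) (B : ℝ),
      IsSuitableWeakSolutionOn (slab (EuclideanSpace ℝ (Fin 3)) (Set.Iio 0) isOpen_Iio) 0 0 u p →
      HasWeakSpatialGradientOn (slab (EuclideanSpace ℝ (Fin 3)) (Set.Iio 0) isOpen_Iio) u H →
      (∀ a : ℝ, 0 < a → ENNReal.ofReal (a ^ (2 * ρ)) * cknA a (0 : ℝ × EuclideanSpace ℝ (Fin 3)) u +
        ENNReal.ofReal (a ^ ρ) * cknE a (0 : ℝ × EuclideanSpace ℝ (Fin 3)) H +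
        ENNReal.ofReal (a ^ (2 * ρ)) * cknD a (0 : ℝ × EuclideanSpace ℝ (Fin 3)) p ≤ (c : ℝ≥0∞)) →
      IsClassicalNSSolutionOn (Set.Iio 0) 0 0 u p →
      (∀ τ : ℝ, τ < 0 → ∀ y : EuclideanSpace ℝ (Fin 3),
        u τ y = ((-τ) ^ (-((1 + ρ) / (2 + ρ)))) • V (((-τ) ^ (-(1 / (2 + ρ)))) • y)) →
      (∀ y, ‖V y‖ ≤ B ∧ ‖fderiv ℝ V y‖ ≤ B) →
      volume {y | curl V y ≠ 0} ≠ ⊤ →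
      Function.uncurry u =ᵐ[volume.restrict (Set.Iio (0 : ℝ) ×ˢ (Set.univ : Set (EuclideanSpace ℝ (Fin 3))))] 0 := by
  intro ρ hρ u p H c V B _ hH hc hns hss hB hfin
  have hV : V = u (-1) := profile_eq_slice hss
  have hVs := hns.contDiff_velocity (show (-1 : ℝ) ∈ Set.Iio 0 by norm_num)
  rw [← hV] at hVs
  have hVd : Differentiable ℝ V := hVs.differentiable (by simp)
  exact ae_eq_zero_of_gauge_of_dss_vorticitySupport hρ hH hc hns one_lt_two (dss_of_selfSimilar hρ hss two_pos)
    (selfSimilar_slice_bounds hρ hss hVd hB) (selfSimilar_vorticitySupport_bounds hρ hss hVd hfin)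

/-- The stratum is a literal sub-case of the route decl `PowerGaugeEulerLiouville` (strictly inside the crux
E, never summit-strength). [folklore] -/
theorem dss_vorticitySupport_of_powerGaugeEulerLiouville
    (hE : Summit.NavierStokesRegularity.NavierStokesRegularity.Theses.EulerZoomLiouville.PowerGaugeEulerLiouville) :
    ∀ ρ : ℝ, 0 < ρ → ∀ (u : ℝ → EuclideanSpace ℝ (Fin 3) → EuclideanSpace ℝ (Fin 3))
      (p : ℝ → EuclideanSpace ℝ (Fin 3) → ℝ)
      (H : ℝ → EuclideanSpace ℝ (Fin 3) → EuclideanSpace ℝ (Fin 3) →L[ℝ] EuclideanSpace ℝ (Fin 3)) (c : ℝ≥0)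
      (l : ℝ),
      IsSuitableWeakSolutionOn (slab (EuclideanSpace ℝ (Fin 3)) (Set.Iio 0) isOpen_Iio) 0 0 u p →
      HasWeakSpatialGradientOn (slab (EuclideanSpace ℝ (Fin 3)) (Set.Iio 0) isOpen_Iio) u H →
      (∀ a : ℝ, 0 < a → ENNReal.ofReal (a ^ (2 * ρ)) * cknA a (0 : ℝ × EuclideanSpace ℝ (Fin 3)) u +
        ENNReal.ofReal (a ^ ρ) * cknE a (0 : ℝ × EuclideanSpace ℝ (Fin 3)) H +
        ENNReal.ofReal (a ^ (2 * ρ)) * cknD a (0 : ℝ × EuclideanSpace ℝ (Fin 3)) p ≤ (c : ℝ≥0∞)) →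
      IsClassicalNSSolutionOn (Set.Iio 0) 0 0 u p →
      1 < l →
      (∀ τ : ℝ, τ < 0 → ∀ y, u τ y = (l ^ (1 + ρ)) • u ((l ^ (2 + ρ)) * τ) (l • y)) →
      Function.uncurry u =ᵐ[volume.restrict (Set.Iio (0 : ℝ) ×ˢ (Set.univ : Set (EuclideanSpace ℝ (Fin 3))))] 0 :=
  fun ρ hρ u p H c _ hsw hH hc _ _ _ => hE ρ hρ u p H c hsw hH hc

end Summit.NavierStokesRegularity.NavierStokesRegularity.Theorems.PowerGaugeEulerLiouville.VorticitySupport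

end
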